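import Summits.Ventures.PercRepro.S1TriangleSevenE

/-!
# PercRepro — `P(7) = 11`, PART 5: the theorem (p2, gen 17)

`s₃ ≤ 11` at nullity `7` under (C1)–(C3) — the census value of the cell's triangle cap — from S1TriangleSeven
(`≤ 12`), CASE A (S1TriangleSevenB) and CASE B (S1TriangleSevenE): on a coloop-free matroid with twelve triangles
every point has degree `≥ 2`, none has degree `2`, a degree `≥ 4` would make `3m + 1 ≤ 36` with `m ≥ 12`, so every
degree is `3` and `m = 12`. One recursion step gives `s₃ ≤ 14` at nullity `8`.

* **`ncard_triangles_le_eleven_of_nullity_seven`**, **`ncard_triangles_le_fourteen_of_nullity_eight`**;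
* the core forms `core_ncard_triangles_le_eleven_of_nullity_seven`, `core_ncard_triangles_le_fourteen_of_nullity_eight`.
Axioms: standard.
-/

open scoped Matroid

namespace PercRepro

namespace S1

open Set

variable {α : Type}

/-- **Nullity `7`: at most eleven triangles** under (C1), (C2), (C3) — the census value `P(7) = 11`. -/
theorem ncard_triangles_le_eleven_of_nullity_seven (M : Matroid α) [M.Finite]
    (hC1 : ∀ L ⊆ M.E, M.eRk L = 2 → L.ncard ≤ 3) (hC2 : ∀ P ⊆ M.E, M.eRk P ≤ 3 → P.ncard ≤ 6)
    (hC3 : ∀ X ⊆ M.E, M.eRk X ≤ 4 → X.ncard ≤ 10) (hd : M.E.encard = M.eRank + ((7 : ℕ) : ℕ∞)) :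
    (ThmN.triangles M).ncard ≤ 11 := by
  suffices H : ∀ n : ℕ, ∀ (M : Matroid α) [M.Finite], M.E.ncard = n →
      (∀ L ⊆ M.E, M.eRk L = 2 → L.ncard ≤ 3) → (∀ P ⊆ M.E, M.eRk P ≤ 3 → P.ncard ≤ 6) →
      (∀ X ⊆ M.E, M.eRk X ≤ 4 → X.ncard ≤ 10) →
      M.E.encard = M.eRank + ((7 : ℕ) : ℕ∞) → (ThmN.triangles M).ncard ≤ 11 from
    H _ M rfl hC1 hC2 hC3 hd
  intro n
  induction n using Nat.strong_induction_on with
  | _ n ih =>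
  intro M _ hn hC1 hC2 hC3 hd
  classical
  by_cases hcol : ∃ k ∈ M.E, M.IsColoop k
  · obtain ⟨k, hkE, hk⟩ := hcol
    have hlt : (M ＼ {k}).E.ncard < n := by
      rw [_root_.Matroid.delete_ground, ← hn]
      exact Set.ncard_sdiff_singleton_lt_of_mem hkE M.ground_finite
    have hC1' : ∀ L ⊆ (M ＼ {k}).E, (M ＼ {k}).eRk L = 2 → L.ncard ≤ 3 := by
      intro L hL hr
      rw [_root_.Matroid.delete_ground] at hL
      rw [delete_singleton_eRk_eq hL] at hr
      exact hC1 L (hL.trans Set.sdiff_subset) hr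
    have hC2' : ∀ P ⊆ (M ＼ {k}).E, (M ＼ {k}).eRk P ≤ 3 → P.ncard ≤ 6 := by
      intro P hP hr
      rw [_root_.Matroid.delete_ground] at hP
      rw [delete_singleton_eRk_eq hP] at hr
      exact hC2 P (hP.trans Set.sdiff_subset) hr
    have hC3' : ∀ X ⊆ (M ＼ {k}).E, (M ＼ {k}).eRk X ≤ 4 → X.ncard ≤ 10 := by
      intro X hX hr
      rw [_root_.Matroid.delete_ground] at hX
      rw [delete_singleton_eRk_eq hX] at hr
      exact hC3 X (hX.trans Set.sdiff_subset) hr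
    have hd' : (M ＼ {k}).E.encard = (M ＼ {k}).eRank + ((7 : ℕ) : ℕ∞) :=
      encard_delete_eq_of_isColoop M hk hd
    have := ih _ hlt (M ＼ {k}) rfl hC1' hC2' hC3' hd'
    rwa [triangles_delete_eq_of_isColoop M hk] at this
  have hcol' : ∀ x ∈ M.E, ¬ M.IsColoop x := fun x hx h => hcol ⟨x, hx, h⟩
  by_contra hgt
  have h12' := ncard_triangles_le_twelve_of_nullity_seven M hC1 hC2 hC3 hd
  have hs12 : (ThmN.triangles M).ncard = 12 := by omega
  have hSfin : (ThmN.triangles M).Finite :=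
    M.ground_finite.finite_subsets.subset (fun C hC => hC.1.subset_ground)
  obtain ⟨C, hC⟩ : (ThmN.triangles M).Nonempty := by
    rw [← Set.ncard_pos hSfin]; omega
  -- the rank facts: `m ≥ 12`
  obtain ⟨r, hr, hnr, hr2⟩ := two_add_le_eRank_of_triangle M hd hC
  have hE2 : r ≠ 2 ∨ M.E.ncard ≤ 3 := by
    by_cases h : r = 2
    · refine Or.inr (hC1 M.E (subset_refl _) ?_)
      rw [← _root_.Matroid.eRank_def, hr, h]; norm_num
    · exact Or.inl h
  have hE3 : r ≠ 3 ∨ M.E.ncard ≤ 6 := by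
    by_cases h : r = 3
    · refine Or.inr (hC2 M.E (subset_refl _) ?_)
      rw [← _root_.Matroid.eRank_def, hr, h]; norm_num
    · exact Or.inl h
  have hE4 : r ≠ 4 ∨ M.E.ncard ≤ 10 := by
    by_cases h : r = 4
    · refine Or.inr (hC3 M.E (subset_refl _) ?_)
      rw [← _root_.Matroid.eRank_def, hr, h]; norm_num
    · exact Or.inl h
  have hm12 : 12 ≤ M.E.ncard := by omega
  -- every point has degree `≥ 2`, and none has degree `2` (CASE A)
  have hdeg2 : ∀ y ∈ M.E, 2 ≤ (ThmN.trianglesThrough M y).ncard := by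
    intro y hy
    obtain ⟨hd', hC1', hC2', hle⟩ :=
      ncard_triangles_le_add_of_not_isColoop M hC1 hC2 (d := 6) hd hy (hcol' y hy)
    have hC3' : ∀ X ⊆ (M ＼ {y}).E, (M ＼ {y}).eRk X ≤ 4 → X.ncard ≤ 10 := by
      intro X hX hr
      rw [_root_.Matroid.delete_ground] at hX
      rw [delete_singleton_eRk_eq hX] at hr
      exact hC3 X (hX.trans Set.sdiff_subset) hr
    have h10 := ncard_triangles_le_cq (M ＼ {y}) hC1' hC2' hC3' hd'
    rw [show cq 6 = 10 by decide] at h10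
    omega
  have hdeg3 : ∀ y ∈ M.E, 3 ≤ (ThmN.trianglesThrough M y).ncard := by
    intro y hy
    by_contra h
    have h2 : (ThmN.trianglesThrough M y).ncard = 2 := by have := hdeg2 y hy; omega
    exact not_degree_two_of_twelve_triangles M hC1 hC2 hC3 hd hcol' hs12 hm12 hy h2
  -- every point has degree exactly `3` and `m = 12` (CASE B)
  have hdeg : ∀ y ∈ M.E, (ThmN.trianglesThrough M y).ncard = 3 := by
    intro y hy
    by_contra h
    have h4 : 3 + 1 ≤ (ThmN.trianglesThrough M y).ncard := by have := hdeg3 y hy; omega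
    have := mul_ncard_ground_add_one_le_three_mul_ncard_triangles M 3 hdeg3 hy h4
    omega
  have hm : M.E.ncard = 12 := by
    have := mul_ncard_ground_le_three_mul_ncard_triangles M 3 hdeg3
    omega
  exact not_all_degree_three_of_twelve_triangles M hC1 hC2 hC3 hs12 hm hdeg

/-- **Nullity `8`: at most fourteen triangles** under (C1), (C2), (C3) (one recursion step from `11`). -/
theorem ncard_triangles_le_fourteen_of_nullity_eight (M : Matroid α) [M.Finite]
    (hC1 : ∀ L ⊆ M.E, M.eRk L = 2 → L.ncard ≤ 3) (hC2 : ∀ P ⊆ M.E, M.eRk P ≤ 3 → P.ncard ≤ 6)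
    (hC3 : ∀ X ⊆ M.E, M.eRk X ≤ 4 → X.ncard ≤ 10) (hd : M.E.encard = M.eRank + ((8 : ℕ) : ℕ∞)) :
    (ThmN.triangles M).ncard ≤ 14 := by
  suffices H : ∀ n : ℕ, ∀ (M : Matroid α) [M.Finite], M.E.ncard = n →
      (∀ L ⊆ M.E, M.eRk L = 2 → L.ncard ≤ 3) → (∀ P ⊆ M.E, M.eRk P ≤ 3 → P.ncard ≤ 6) →
      (∀ X ⊆ M.E, M.eRk X ≤ 4 → X.ncard ≤ 10) →
      M.E.encard = M.eRank + ((8 : ℕ) : ℕ∞) → (ThmN.triangles M).ncard ≤ 14 from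
    H _ M rfl hC1 hC2 hC3 hd
  intro n
  induction n using Nat.strong_induction_on with
  | _ n ih =>
  intro M _ hn hC1 hC2 hC3 hd
  classical
  by_cases hcol : ∃ k ∈ M.E, M.IsColoop k
  · obtain ⟨k, hkE, hk⟩ := hcol
    have hlt : (M ＼ {k}).E.ncard < n := by
      rw [_root_.Matroid.delete_ground, ← hn]
      exact Set.ncard_sdiff_singleton_lt_of_mem hkE M.ground_finite
    have hC1' : ∀ L ⊆ (M ＼ {k}).E, (M ＼ {k}).eRk L = 2 → L.ncard ≤ 3 := by
      intro L hL hr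
      rw [_root_.Matroid.delete_ground] at hL
      rw [delete_singleton_eRk_eq hL] at hr
      exact hC1 L (hL.trans Set.sdiff_subset) hr
    have hC2' : ∀ P ⊆ (M ＼ {k}).E, (M ＼ {k}).eRk P ≤ 3 → P.ncard ≤ 6 := by
      intro P hP hr
      rw [_root_.Matroid.delete_ground] at hP
      rw [delete_singleton_eRk_eq hP] at hr
      exact hC2 P (hP.trans Set.sdiff_subset) hr
    have hC3' : ∀ X ⊆ (M ＼ {k}).E, (M ＼ {k}).eRk X ≤ 4 → X.ncard ≤ 10 := by
      intro X hX hr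
      rw [_root_.Matroid.delete_ground] at hX
      rw [delete_singleton_eRk_eq hX] at hr
      exact hC3 X (hX.trans Set.sdiff_subset) hr
    have hd' : (M ＼ {k}).E.encard = (M ＼ {k}).eRank + ((8 : ℕ) : ℕ∞) :=
      encard_delete_eq_of_isColoop M hk hd
    have := ih _ hlt (M ＼ {k}) rfl hC1' hC2' hC3' hd'
    rwa [triangles_delete_eq_of_isColoop M hk] at this
  have hcol' : ∀ x ∈ M.E, ¬ M.IsColoop x := fun x hx h => hcol ⟨x, hx, h⟩
  by_contra hgt
  have h15 : 15 ≤ (ThmN.triangles M).ncard := by omega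
  have hSfin : (ThmN.triangles M).Finite :=
    M.ground_finite.finite_subsets.subset (fun C hC => hC.1.subset_ground)
  obtain ⟨C, hC⟩ : (ThmN.triangles M).Nonempty := by
    rw [← Set.ncard_pos hSfin]; omega
  obtain ⟨r, hr, hnr, hr2⟩ := two_add_le_eRank_of_triangle M hd hC
  have hE2 : r ≠ 2 ∨ M.E.ncard ≤ 3 := by
    by_cases h : r = 2
    · refine Or.inr (hC1 M.E (subset_refl _) ?_)
      rw [← _root_.Matroid.eRank_def, hr, h]; norm_num
    · exact Or.inl h
  have hE3 : r ≠ 3 ∨ M.E.ncard ≤ 6 := by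
    by_cases h : r = 3
    · refine Or.inr (hC2 M.E (subset_refl _) ?_)
      rw [← _root_.Matroid.eRank_def, hr, h]; norm_num
    · exact Or.inl h
  have hE4 : r ≠ 4 ∨ M.E.ncard ≤ 10 := by
    by_cases h : r = 4
    · refine Or.inr (hC3 M.E (subset_refl _) ?_)
      rw [← _root_.Matroid.eRank_def, hr, h]; norm_num
    · exact Or.inl h
  have hm13 : 13 ≤ M.E.ncard := by omega
  obtain ⟨x, hxE, hx⟩ := exists_degree_mul_le M ⟨_, hC.1.subset_ground hC.1.nonempty.some_mem⟩
  obtain ⟨hd', hC1', hC2', hle⟩ :=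
    ncard_triangles_le_add_of_not_isColoop M hC1 hC2 (d := 7) hd hxE (hcol' x hxE)
  have hC3' : ∀ X ⊆ (M ＼ {x}).E, (M ＼ {x}).eRk X ≤ 4 → X.ncard ≤ 10 := by
    intro X hX hr
    rw [_root_.Matroid.delete_ground] at hX
    rw [delete_singleton_eRk_eq hX] at hr
    exact hC3 X (hX.trans Set.sdiff_subset) hr
  have h11 := ncard_triangles_le_eleven_of_nullity_seven (M ＼ {x}) hC1' hC2' hC3' hd'
  have h1 : 4 ≤ (ThmN.trianglesThrough M x).ncard := by omega
  have h2 : (ThmN.trianglesThrough M x).ncard * 13 ≤ (ThmN.trianglesThrough M x).ncard * M.E.ncard :=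
    Nat.mul_le_mul_left _ hm13
  omega

/-- **The census cap `P(7) = 11` on the `e`-free core.** -/
theorem core_ncard_triangles_le_eleven_of_nullity_seven (M : Matroid α) [M.Finite]
    (hfree : ∀ e ∈ M.E, ∃ A ⊆ M.E \ {e}, e ∉ M.closure A ∧ e ∉ M.closure ((M.E \ {e}) \ A))
    (hd : M.E.encard = M.eRank + ((7 : ℕ) : ℕ∞)) :
    {C : Set α | M.IsCircuit C ∧ C.ncard = 3}.ncard ≤ 11 := by
  have hL : ∀ e ∈ M.E, ¬ M.IsLoop e := ThmN.not_isLoop_of_free M hfree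
  have hline : ∀ L ⊆ M.E, M.eRk L = 2 → L.ncard ≤ 3 := by
    intro L hL' hr
    have := ThmN.ncard_add_one_le_two_pow_of_eRk_le M hL hfree 2 L hL' hr.le
    omega
  have hplane : ∀ P ⊆ M.E, M.eRk P ≤ 3 → P.ncard ≤ 6 := fun P hP hr =>
    ThmN.ncard_le_six_of_eRk_le_three_of_free M hfree hP hr
  have hsolid : ∀ X ⊆ M.E, M.eRk X ≤ 4 → X.ncard ≤ 10 := fun X hX hr =>
    ThmN.ncard_le_ten_of_eRk_le_four_of_free M hfree hX hr
  exact ncard_triangles_le_eleven_of_nullity_seven M hline hplane hsolid hd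

/-- **`s₃ ≤ 14` at nullity `8` on the `e`-free core.** -/
theorem core_ncard_triangles_le_fourteen_of_nullity_eight (M : Matroid α) [M.Finite]
    (hfree : ∀ e ∈ M.E, ∃ A ⊆ M.E \ {e}, e ∉ M.closure A ∧ e ∉ M.closure ((M.E \ {e}) \ A))
    (hd : M.E.encard = M.eRank + ((8 : ℕ) : ℕ∞)) :
    {C : Set α | M.IsCircuit C ∧ C.ncard = 3}.ncard ≤ 14 := by
  have hL : ∀ e ∈ M.E, ¬ M.IsLoop e := ThmN.not_isLoop_of_free M hfree
  have hline : ∀ L ⊆ M.E, M.eRk L = 2 → L.ncard ≤ 3 := by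
    intro L hL' hr
    have := ThmN.ncard_add_one_le_two_pow_of_eRk_le M hL hfree 2 L hL' hr.le
    omega
  have hplane : ∀ P ⊆ M.E, M.eRk P ≤ 3 → P.ncard ≤ 6 := fun P hP hr =>
    ThmN.ncard_le_six_of_eRk_le_three_of_free M hfree hP hr
  have hsolid : ∀ X ⊆ M.E, M.eRk X ≤ 4 → X.ncard ≤ 10 := fun X hX hr =>
    ThmN.ncard_le_ten_of_eRk_le_four_of_free M hfree hX hr
  exact ncard_triangles_le_fourteen_of_nullity_eight M hline hplane hsolid hd


end S1

end PercRepro
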